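import Summits.HodgeConjecture.HodgeConjecture.Theorems.Ring2DeformCompactPencils
import Literature.AlgebraicGeometry.HodgeTheory.MotivatedClassesDeformationInputs
import Literature.AlgebraicGeometry.HodgeTheory.AlgebraicClassesFibreRestriction
import Literature.AlgebraicGeometry.HodgeTheory.TopDegreeClasses
import HarnessLib

/-!
# Ring 2 · sub-cell AbelianAll (ALL ABELIAN VARIETIES), André axis, part I — `HC_CM + B_min ⟹ HC_AV`: the
# candidates for `B_min` on compact pencils of abelian varieties, the kernel edges between them, and the
# assembled theorem with `B_min` = CM-anchored transport (part II, `Ring2AbelianAllAndreLefschetz`: the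
# Lefschetz-`B` candidates through Milne 2020 Prop. 1, and the fact-free existential node)

HONEST FRAMING (page 1, verbatim): **research route, not a corollary; conditional on HC_CM plus one named
minimal statement.** Cell line: research route conditional on HC_CM; not a corollary; Q11.4-sentence-2
already refuted in dim ≥ 3. Nothing in this file proves a case of the Hodge conjecture. `HC_CM` is the tree
item `Theses.RankFourFaces.CMAbelianHodge` (stmt-HodgeConjecture-3052), a BINDER wherever it occurs, never
cited, never an axiom; `HC_AV` is `Theses.PadicSemiregularLift.HodgeAbelianVarieties` (stmt-1333); the
reduction item `HC_CM ⟹ HC_AV` is `Theses.RankFourFaces.CMToAbelian` (stmt-16267, OPEN — not closed here).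
Seat `pub-hodge-ring2-ab-andre-2`; answers the sub-cell referee's requests R-ab-1 (type candidates 3 and 4
of REFEREE-AB.md R-01 and land `HC_AV` from `HC_CM` and them) and F-ab-3/F-ab-4 (say where `HC_CM` is idle;
file the open converses; no absolute "minimal" claim).

## The published inputs, and how they enter

* André 1996, Lemme 6.3.1 [Andre1996Motifs, p. 31] — the CM-anchored compact pencil through every Hodge
  class of every complex abelian variety: the tree's NAMED FACT `Andre1996.andre1996_cmAnchoredPencil`
  (a theorem in print, not formalised), hypothesis `h₂₁` below. Every headline "`HC_CM` + one statement"
  of this file is honest only as "… modulo Lemme 6.3.1" (REFEREE-AB (ii)); the fact-free row is §E of part II.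
* Milne 2020, Prop. 1 (= Abdulali 1994, p. 1122) [Milne2020HodgeClassesAV, Prop. 1 (p. 7)]: the Lefschetz
  standard conjecture for the TOTAL SPACE of an abelian scheme over a smooth complete base implies transport
  of algebraicity along it — consumed in part II (§D) as an explicit hypothesis shape (NOT vendored by this
  seat: request R-ab-2 of the sub-cell). Its proof's last line is where the lift nodes (L), (L∀) of §B come
  from (`a H^{2r}(A_s)^π = a H⁰(S, R^{2r}f_*ℚ)`).
* The two tree THEOREMS that make every "lift" row run: flatness of the fibre restrictions of a global class
  (`HodgeTheory.Andre1996_deformation_hflat`, input (A4) of André's Thm. 0.5, §5.1, from Ehresmann on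
  complex points) and restriction of algebraic classes of the total space to the fibres
  (`HodgeTheory.map_fiberι_mem_algebraicClasses`, Fulton Cor. 10.1 / 19.2 (b) on the support carrier).

## The candidates (all OPEN; hypotheses wherever used; numbering of REFEREE-AB R-01 (iii))

* (2) `Deform.CompactAbelianPencilVHC` (deform part IV): transport of algebraicity on EVERY compact pencil
  of abelian varieties. With Lemmes 6.3.1–6.3.3 it is EQUIVALENT to `HC_AV` and `HC_CM` is IDLE next to it.
* (3) `CMPointedPencilVHC` (§A): the same on compact pencils HAVING A CM FIBRE.
* (4) `CMAnchoredTransport` (§A): on a compact pencil, algebraicity spreads OUT OF a CM fibre to every fibre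
  (one direction only; nothing is asked of pencils without CM fibres, nor of transport into a CM fibre).
* (L) `CMFibreAlgebraicLift` (§B): Grothendieck's specialisation surjectivity `Aᵖ(𝒳) ↠ Aᵖ(𝒳_t)^{inv}` at a
  CM fibre `t` — every fibrewise-Hodge global class algebraic on the CM fibre agrees there with a global
  ALGEBRAIC class of the total space. Cycle-theoretic ("find the cycle on the `(d+1)`-fold `𝒳`").
* (L∀) `AlgebraicFixedPart` (§B): the same at EVERY fibre (the algebraic "théorème de la partie fixe").
* part II: (5) `LefschetzBCMPointedPencils` / (5∀) `LefschetzBCompactPencils` — `B*` (Lefschetz involution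
  algebraic) for the TOTAL SPACE of compact pencils of abelian varieties (with a CM fibre / all; André's
  Remarque 2, p. 33), and (T∃) `CMAnchoredPencilTransport` — per Hodge class, SOME CM-anchored compact pencil
  along which algebraicity spreads out of CM fibres (the only node reaching `HC_AV` from `HC_CM` with no
  named fact).

## Kernel edges of this part (K), and what is deliberately NOT claimed

(2) ⟹ (3) ⟹ (4); (L∀) ⟹ (L) ⟹ (4); (L∀) ⟹ (2); `HC_CM ∧ (4) ⟹ HC_AV` (mod `h₂₁`) = `HC_AV_of_HC_CM_and_Bmin`;
`HC_AV ⟹ (3), (4)`; EXACTNESS `HC_AV ↔ HC_CM ∧ (4) ↔ HC_CM ∧ (3)` (mod `h₂₁`); `CMToAbelian ↔ (HC_CM → (4))`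
(mod `h₂₁`); under `HC_CM` the candidates (2), (3), (4) coincide; KIND-1 witness: (L∀) ⟹ `HC_CM` (mod
Lemmes 6.3.2–6.3.3). NOT claimed (OPEN converses, REFEREE-AB F-ab-4): (4) ⟹ (3), (3) ⟹ (2), (L) ⟹ (L∀);
no candidate is called minimal in the absolute sense — (4) is the weakest statement of this part proved
sufficient (and, granted `h₂₁`, necessary); part II weakens it further to (T∃).

## HONEST COLUMN — where `HC_CM` is load-bearing, kernel versus print

In the KERNEL, `HC_CM` is load-bearing next to (3), (4), (L): none of them is combined anywhere in the tree
with a printed fact to yield `HC_CM` (the typed Lemmes 6.3.2–6.3.3,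
`andre1996_cmHodgeClasses_algebraicallyAnchoredPencils`, record an ALGEBRAIC anchor fibre `s₀`, not a CM one).
In PRINT, (3), (4), (L) are dominated exactly like (2): the anchor `X_{s₀}` of Lemme 6.3.3 is a power of an
elliptic curve which may be taken with complex multiplication ([KuM91] §2 as cited on p. 33; deform part IV,
honest column (3)), so "transport out of CM fibres" on all CM-pointed compact pencils re-derives `HC_CM`.
Only the existential node (T∃) of part II — whose pencil is required to have a CM anchor and nothing else —
is `HC_CM`-complementary in print as well. This is why the sub-cell keeps `HC_CM` as a hypothesis (F-ab-3).

References: Andre1996Motifs (Lemmes 6.3.1–6.3.3, Remarque 2, pp. 31–33; Thm. 0.5, §5.1); Milne2020HodgeClassesAV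
(Prop. 1, Thm. 4, Rem. 2–3); Abdulali1994FamiliesAV ((1.1), Lemma 6.2, p. 1122); CharlesSchnell2014Notes
(Conj. 11.3.1, Cor. 11.3.6); Kleiman1968AlgebraicCycles (§2, Thm. 2A11); Lieberman1968; VoisinHodgeII2003 (§3.1.2).
-/

noncomputable section

set_option linter.dupNamespace false

namespace Summit.HodgeConjecture.HodgeConjecture.Ring2.AbelianAll

open CategoryTheory AlgebraicGeometry MonoidalCategory
open Literature.AlgebraicGeometry Literature.AlgebraicGeometry.Motives
open Literature.AlgebraicGeometry.HodgeTheory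
open Literature.AlgebraicGeometry.Milne1999 (IsOfCMType)
open Literature.AlgebraicGeometry.Abdulali1994 (InvariantCyclesHoldFor)
open Literature.AlgebraicGeometry.Andre1996 (andre1996_cmAnchoredPencil
  andre1996_cmHodgeClasses_algebraicallyAnchoredPencils IsCMAnchoredPencilFor)
open Literature.AlgebraicGeometry.Deligne1982 (cmLocus)
open Summit.HodgeConjecture.HodgeConjecture
open Summit.HodgeConjecture.HodgeConjecture.Theses
open Summit.HodgeConjecture.HodgeConjecture.Ring2.Deform (CompactAbelianPencilVHC compactAbelianPencilVHC_of_HC_AV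
  HC_AV_of_andre1996_of_compactAbelianPencilVHC HC_CM_of_andre1996_of_compactAbelianPencilVHC HC_CM_of_HC_AV
  HC_AV_of_hodgeConjecture)
open Summit.HodgeConjecture.HodgeConjecture.Theorems.HodgeAbelianVarieties.Negative (iff_hodgeConjecture_restricted)

variable {𝒳 S : SchemeOver ℂ}

/-! ## §0 Carrier lemmas for compact pencils (no hypothesis of the cell) -/

/-- A CM fibre of a compact pencil of relative dimension `d`, presented by a CM abelian variety `A₀` with
`A₀.X ≅ 𝒳_t`, is a point of the CM locus `cmLocus f d` (the dimension clause is automatic: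
`Andre1996.compactPencil_dim_eq_of_iso`). [cite: Deligne1982HodgeCycles, §6 proof of Prop. 6.1 (p. 73)] -/
theorem mem_cmLocus_of_compactPencil {f : 𝒳 ⟶ S} {d : ℕ} (hf : IsCompactAbelianPencil f d)
    {t : ComplexPoints S} {A₀ : AbelianVariety ℂ} (e₀ : A₀.X ≅ fiberOver f t) (hA₀ : IsOfCMType A₀) :
    t ∈ cmLocus f d :=
  ⟨A₀, ⟨e₀⟩, Andre1996.compactPencil_dim_eq_of_iso hf e₀, hA₀⟩

/-- **The engine of every "lift" row: on a compact pencil, a global class that agrees on ONE fibre with a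
global ALGEBRAIC class is algebraic on EVERY fibre.** The difference of the two classes restricts to `0` at
`t`, hence at every `s` (restrictions of a global class form a flat section of the local system `R^{2p}f_*ℂ`
over the connected `S(ℂ)` — Ehresmann + transport, the tree's PROVED `Andre1996_deformation_hflat`, input
(A4) of André's proof of Thm. 0.5), and the restriction of an algebraic class of the total space to a fibre
is algebraic (specialisation of cycles, the tree's PROVED `map_fiberι_mem_algebraicClasses`). The base of a
compact pencil is a smooth projective curve: smooth, quasi-projective, irreducible, with connected complex
points. [cite: Andre1996Motifs, §5.1 (p. 25)] [cite: VoisinHodgeII2003, §3.1.2]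
[cite: Fulton1998, §10.1 Cor. 10.1 and §19.2 Cor. 19.2 (b)] -/
theorem map_fiberι_mem_algebraicClasses_of_lift {f : 𝒳 ⟶ S} {d : ℕ} (hf : IsCompactAbelianPencil f d)
    {p : ℕ} {W η : complexBetti 𝒳 (2 * p)} (hη : η ∈ algebraicClasses 𝒳 p) {t : ComplexPoints S}
    (ht : complexBetti.map (fiberι f t) (2 * p) η = complexBetti.map (fiberι f t) (2 * p) W)
    (s : ComplexPoints S) :
    complexBetti.map (fiberι f s) (2 * p) W ∈ algebraicClasses (fiberOver f s) p := by
  have hS : AlgebraicGeometry.Smooth S.hom := Andre1996.compactPencil_smooth_base hf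
  have hSqp : IsQuasiProjectiveOver S :=
    IsQuasiProjectiveOver.of_isProjectiveOver hf.isSmoothProjective_base.isProjectiveOver
  have hconn : ConnectedSpace (ComplexPoints S) := connectedSpace_complexPoints hf.isSmoothProjective_base
  haveI : IrreducibleSpace S.left := Andre1996.compactPencil_irreducibleSpace_base hf
  haveI := hS
  have h0 : complexBetti.map (fiberι f t) (2 * p) (η - W) = 0 := by
    rw [map_sub, ht, sub_self]
  have h1 : complexBetti.map (fiberι f s) (2 * p) (η - W) = 0 :=
    Andre1996_deformation_hflat f hf.isSmoothProjectiveFamily hS hSqp hconn (2 * p) (η - W) t s h0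
  have h2 : complexBetti.map (fiberι f s) (2 * p) W = complexBetti.map (fiberι f s) (2 * p) η := by
    rw [map_sub, sub_eq_zero] at h1
    exact h1.symm
  rw [h2]
  exact map_fiberι_mem_algebraicClasses f hf.isSmoothProjectiveFamily hSqp hη s

/-! ## §A Candidates (3) and (4): transport on CM-pointed compact pencils / out of CM fibres -/

/-- **(3) `CMPointedPencilVHC` — variational Hodge on compact pencils of abelian varieties HAVING A CM
FIBRE** (REFEREE-AB R-01 (iii) 3, R-ab-1): for every compact pencil `f : 𝒳 ⟶ S` of relative dimension `d`
(`Motives.IsCompactAbelianPencil`) whose CM locus `Deligne1982.cmLocus f d` is non-empty, Grothendieck's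
transport of algebraicity `Abdulali1994.InvariantCyclesHoldFor f d` holds (a global class, rational `(p,p)`
on every fibre, algebraic on one fibre, is algebraic on every fibre). Weaker-or-equal than
`Deform.CompactAbelianPencilVHC` as a statement (`cmPointedPencilVHC_of_compactAbelianPencilVHC`); the
converse is OPEN and not claimed. OPEN; a HYPOTHESIS wherever used; implied by `HC_AV`.
[cite: Andre1996Motifs, Lemme 6.3.1 (p. 31) and Remarque 2 (p. 33)] [cite: Abdulali1994FamiliesAV, (1.1) (p. 1122)] -/
@[conjecture] def CMPointedPencilVHC : Prop :=
  ∀ ⦃d : ℕ⦄ ⦃𝒳 S : SchemeOver ℂ⦄ (f : 𝒳 ⟶ S), IsCompactAbelianPencil f d → (cmLocus f d).Nonempty →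
    InvariantCyclesHoldFor f d

/-- **(4) `CMAnchoredTransport` — on a compact pencil of abelian varieties, algebraicity spreads OUT OF a
CM fibre** (REFEREE-AB R-01 (iii) 4, R-ab-1): for every compact pencil `f : 𝒳 ⟶ S` of relative dimension
`d`, every global class `W ∈ H^{2p}(𝒳(ℂ); ℂ)` whose restriction to every fibre is rational of type `(p,p)`,
and every CM point `t ∈ cmLocus f d`: if `W|_{𝒳_t}` is algebraic then `W|_{𝒳_s}` is algebraic for every `s`.
This is exactly what André's step a) (p. 33) / Abdulali's Lemma 6.2 USE of the variational input: transport
from the CM fibre `t` of Lemme 6.3.1 only. Weaker-or-equal than (3) (`cmAnchoredTransport_of_cmPointedPencilVHC`);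
the converse is OPEN. OPEN; a HYPOTHESIS wherever used; implied by `HC_AV`; with `HC_CM` and Lemme 6.3.1 it
gives `HC_AV` (`HC_AV_of_HC_CM_and_Bmin`) and is the `B_min` of that theorem.
[cite: Andre1996Motifs, §6.3 a) (p. 33)] [cite: Abdulali1994FamiliesAV, Lemma 6.2 (p. 1131)] -/
@[conjecture] def CMAnchoredTransport : Prop :=
  ∀ ⦃d : ℕ⦄ ⦃𝒳 S : SchemeOver ℂ⦄ (f : 𝒳 ⟶ S), IsCompactAbelianPencil f d →
    ∀ (p : ℕ) (W : complexBetti 𝒳 (2 * p)),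
      (∀ s : ComplexPoints S, IsRationalClass (complexBetti.map (fiberι f s) (2 * p) W) ∧
        IsOfHodgeType d (fiberOver f s) (2 * p) p p (complexBetti.map (fiberι f s) (2 * p) W)) →
      ∀ t ∈ cmLocus f d,
        complexBetti.map (fiberι f t) (2 * p) W ∈ algebraicClasses (fiberOver f t) p →
        ∀ s : ComplexPoints S, complexBetti.map (fiberι f s) (2 * p) W ∈ algebraicClasses (fiberOver f s) p

/-- **(2) ⟹ (3)**: transport on all compact pencils gives it on the CM-pointed ones. [folklore] -/
theorem cmPointedPencilVHC_of_compactAbelianPencilVHC (h : CompactAbelianPencilVHC) : CMPointedPencilVHC :=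
  fun _ _ _ f hf _ ↦ h f hf

/-- **(3) ⟹ (4)**: a CM point `t` makes the pencil CM-pointed, and (3) transports from any algebraic fibre,
in particular from `t`. The converse (4) ⟹ (3) is OPEN (transport INTO the CM fibre / between two non-CM
fibres is not provided by (4)). [cite: Andre1996Motifs, §6.3 a) (p. 33)] -/
theorem cmAnchoredTransport_of_cmPointedPencilVHC (h : CMPointedPencilVHC) : CMAnchoredTransport :=
  fun _ _ _ f hf p W hW t ht h₀ s ↦ h f hf ⟨t, ht⟩ p W hW ⟨t, h₀⟩ s

/-- ON-PATH: `HC_AV ⟹ (3)` (through deform's `compactAbelianPencilVHC_of_HC_AV`, Charles–Schnell Cor. 11.3.6 on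
compact pencils). [cite: CharlesSchnell2014Notes, Cor. 11.3.6 (p. 494)] -/
theorem cmPointedPencilVHC_of_HC_AV (h : PadicSemiregularLift.HodgeAbelianVarieties) : CMPointedPencilVHC :=
  cmPointedPencilVHC_of_compactAbelianPencilVHC (compactAbelianPencilVHC_of_HC_AV h)

/-- ON-PATH: `HC_AV ⟹ (4)`. [cite: CharlesSchnell2014Notes, Cor. 11.3.6 (p. 494)] -/
theorem cmAnchoredTransport_of_HC_AV (h : PadicSemiregularLift.HodgeAbelianVarieties) : CMAnchoredTransport :=
  cmAnchoredTransport_of_cmPointedPencilVHC (cmPointedPencilVHC_of_HC_AV h)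

/-- ON-PATH: `HodgeConjecture ⟹ (4)`. [folklore] -/
theorem cmAnchoredTransport_of_hodgeConjecture (h : _root_.HodgeConjecture) : CMAnchoredTransport :=
  cmAnchoredTransport_of_HC_AV (HC_AV_of_hodgeConjecture h)

/-! ## §B The cycle-theoretic lift nodes (L), (L∀) and their edges -/

/-- **(L) `CMFibreAlgebraicLift` — specialisation surjectivity `Aᵖ(𝒳) ↠ Aᵖ(𝒳_t)^{inv}` at CM fibres of
compact pencils of abelian varieties** (Grothendieck's invariant-cycle statement for ALGEBRAIC classes, read
at one CM fibre; the algebraic analogue of input (A3) of André's proof of Thm. 0.5, §5.1: "`ξ_s` provient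
d'un cycle motivé sur `X̄`"): for every compact pencil `f : 𝒳 ⟶ S` of relative dimension `d`, every global
class `W` with rational `(p,p)` fibre restrictions and every CM point `t ∈ cmLocus f d`, if `W|_{𝒳_t}` is
algebraic then some ALGEBRAIC class `η ∈ Nᵖ H^{2p}(𝒳(ℂ); ℂ)` of the `(d+1)`-dimensional total space has
`η|_{𝒳_t} = W|_{𝒳_t}` — "find the cycle on `𝒳`". OPEN; a HYPOTHESIS wherever used; (L) ⟹ (4)
(`cmAnchoredTransport_of_cmFibreAlgebraicLift`). In print it follows from the Lefschetz standard conjecture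
for `𝒳` (Milne 2020, proof of Prop. 1: `a H^{2r}(A_s)^π = a H⁰(S, R^{2r}f_*ℚ)`).
[cite: Andre1996Motifs, §5.1 (p. 25)] [cite: Milne2020HodgeClassesAV, Prop. 1, last line of the proof (p. 8)] -/
@[conjecture] def CMFibreAlgebraicLift : Prop :=
  ∀ ⦃d : ℕ⦄ ⦃𝒳 S : SchemeOver ℂ⦄ (f : 𝒳 ⟶ S), IsCompactAbelianPencil f d →
    ∀ (p : ℕ) (W : complexBetti 𝒳 (2 * p)),
      (∀ s : ComplexPoints S, IsRationalClass (complexBetti.map (fiberι f s) (2 * p) W) ∧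
        IsOfHodgeType d (fiberOver f s) (2 * p) p p (complexBetti.map (fiberι f s) (2 * p) W)) →
      ∀ t ∈ cmLocus f d,
        complexBetti.map (fiberι f t) (2 * p) W ∈ algebraicClasses (fiberOver f t) p →
        ∃ η ∈ algebraicClasses 𝒳 p,
          complexBetti.map (fiberι f t) (2 * p) η = complexBetti.map (fiberι f t) (2 * p) W

/-- **(L∀) `AlgebraicFixedPart` — the same lift at EVERY fibre of every compact pencil of abelian varieties**
(the "théorème de la partie fixe" for ALGEBRAIC classes: `Aᵖ(𝒳) ↠ Aᵖ(𝒳_{s₀})^{inv}` for all `s₀`; Milne 2020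
Prop. 1 proves it from the Lefschetz standard conjecture for `𝒳`). OPEN; a HYPOTHESIS wherever used. It
implies deform's (2) (`compactAbelianPencilVHC_of_algebraicFixedPart`), hence — KIND 1 — `HC_CM` and `HC_AV`
themselves modulo Lemmes 6.3.1–6.3.3 (`HC_CM_of_andre1996_of_algebraicFixedPart`): recorded to show where the
restriction to CM fibres in (L) matters. [cite: Milne2020HodgeClassesAV, Prop. 1 (p. 7)]
[cite: Andre1996Motifs, Remarque 2 (p. 33)] -/
@[conjecture] def AlgebraicFixedPart : Prop :=
  ∀ ⦃d : ℕ⦄ ⦃𝒳 S : SchemeOver ℂ⦄ (f : 𝒳 ⟶ S), IsCompactAbelianPencil f d →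
    ∀ (p : ℕ) (W : complexBetti 𝒳 (2 * p)),
      (∀ s : ComplexPoints S, IsRationalClass (complexBetti.map (fiberι f s) (2 * p) W) ∧
        IsOfHodgeType d (fiberOver f s) (2 * p) p p (complexBetti.map (fiberι f s) (2 * p) W)) →
      ∀ s₀ : ComplexPoints S,
        complexBetti.map (fiberι f s₀) (2 * p) W ∈ algebraicClasses (fiberOver f s₀) p →
        ∃ η ∈ algebraicClasses 𝒳 p,
          complexBetti.map (fiberι f s₀) (2 * p) η = complexBetti.map (fiberι f s₀) (2 * p) W

/-- **(L) ⟹ (4)**: lift at the CM fibre, then `map_fiberι_mem_algebraicClasses_of_lift` (flatness + fibre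
restriction). [cite: Andre1996Motifs, §5.1 (p. 25) and §6.3 a) (p. 33)] -/
theorem cmAnchoredTransport_of_cmFibreAlgebraicLift (h : CMFibreAlgebraicLift) : CMAnchoredTransport := by
  intro d 𝒳 S f hf p W hW t ht h₀ s
  obtain ⟨η, hη, hηt⟩ := h f hf p W hW t ht h₀
  exact map_fiberι_mem_algebraicClasses_of_lift hf hη hηt s

/-- **(L∀) ⟹ (L)** (restriction to CM fibres). [folklore] -/
theorem cmFibreAlgebraicLift_of_algebraicFixedPart (h : AlgebraicFixedPart) : CMFibreAlgebraicLift :=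
  fun _ _ _ f hf p W hW t _ h₀ ↦ h f hf p W hW t h₀

/-- **(L∀) ⟹ (2)**: lift at the algebraic fibre `s₀`, then `map_fiberι_mem_algebraicClasses_of_lift`.
[cite: Milne2020HodgeClassesAV, Prop. 1 (p. 7)] -/
theorem compactAbelianPencilVHC_of_algebraicFixedPart (h : AlgebraicFixedPart) : CompactAbelianPencilVHC := by
  intro d 𝒳 S f hf p W hW hs₀ s
  obtain ⟨s₀, h₀⟩ := hs₀
  obtain ⟨η, hη, hηt⟩ := h f hf p W hW s₀ h₀
  exact map_fiberι_mem_algebraicClasses_of_lift hf hη hηt s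

/-- **KIND-1 witness for (L∀)**: granted Lemmes 6.3.2–6.3.3 (`h₂₂`), the algebraic fixed part on all compact
pencils already yields `HC_CM` (through (2) and deform's `HC_CM_of_andre1996_of_compactAbelianPencilVHC`) — so
next to (L∀) the hypothesis `HC_CM` would be idle. [cite: Andre1996Motifs, Lemmes 6.3.2–6.3.3 (pp. 32–33)] -/
theorem HC_CM_of_andre1996_of_algebraicFixedPart (h₂₂ : andre1996_cmHodgeClasses_algebraicallyAnchoredPencils)
    (h : AlgebraicFixedPart) : RankFourFaces.CMAbelianHodge :=
  HC_CM_of_andre1996_of_compactAbelianPencilVHC h₂₂ (compactAbelianPencilVHC_of_algebraicFixedPart h)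

/-! ## §C The assembled theorem with `B_min` := (4), and exactness (modulo Lemme 6.3.1) -/

/-- **`HC_AV_of_HC_CM_and_Bmin` — `HC_CM → B_min → HC_AV` with `B_min := CMAnchoredTransport` (4), modulo
André's Lemme 6.3.1 (`h₂₁`, a theorem in print).** Proof = André §6.3 a) / Abdulali Lemma 6.2 on the real
carriers: for a rational `(p,p)` class `c` on `A`, Lemme 6.3.1 gives a compact pencil `f` of relative
dimension `2·dim A` with a CM fibre `𝒳_t ≅ A₀.X`, a fibre `𝒳_s ≅ A₁.X` receiving `g : A ⟶ A₁`, and a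
fibrewise-Hodge global class `W` with `g^*(W|_{𝒳_s}) = q·c`, `q ≠ 0`; `HC_CM` makes `W|_{𝒳_t}` algebraic
(`Ring2Transport.mem_algebraicClasses_of_cmChart`, the ONLY use of `HC_CM`); (4) carries algebraicity to `𝒳_s`;
the chart `e₁` and `g^*` (`map_mem_algebraicClasses_of_abelianVariety`, a tree theorem) bring it back to `q·c`.
research route, not a corollary; conditional on HC_CM plus one named minimal statement.
[cite: Andre1996Motifs, Lemme 6.3.1 (p. 31) and §6.3 a) (p. 33)] [cite: Abdulali1994FamiliesAV, Lemma 6.2 (p. 1131)] -/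
theorem HC_AV_of_HC_CM_and_Bmin (h₂₁ : andre1996_cmAnchoredPencil) (hCM : RankFourFaces.CMAbelianHodge)
    (hB : CMAnchoredTransport) : PadicSemiregularLift.HodgeAbelianVarieties := by
  refine iff_hodgeConjecture_restricted.2 fun A hA ↦ ?_
  refine (hodgeConjectureFor_iff_of_isSmoothProjective nonempty_hodgeModel_holds hA).2 fun p c hc hpp ↦ ?_
  obtain ⟨𝒳, S, f, hf, s, t, W, A₁, A₀, e₁, g, q, hW, hq, hgc, ⟨e₀⟩, hA₀⟩ := h₂₁ A hA p c hc hpp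
  -- `HC_CM` at the CM fibre `𝒳_t ≅ A₀.X`
  have h₀ : complexBetti.map (fiberι f t) (2 * p) W ∈ algebraicClasses (fiberOver f t) p :=
    Ring2Transport.mem_algebraicClasses_of_cmChart hCM A₀ e₀ (Andre1996.compactPencil_dim_eq_of_iso hf e₀)
      hA₀ (hW t).1 (hW t).2
  -- (4): out of the CM fibre `t` to the fibre `s`
  have h₁ := hB f hf p W hW t (mem_cmLocus_of_compactPencil hf e₀ hA₀) h₀ s
  -- across the chart `e₁ : A₁.X ≅ 𝒳_s` and back along `g : A ⟶ A₁`
  have h₂ : complexBetti.map e₁.hom (2 * p) (complexBetti.map (fiberι f s) (2 * p) W) ∈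
      algebraicClasses A₁.X p :=
    (mem_algebraicClasses_map_iff_of_iso e₁).2 h₁
  have h₃ : (q : ℂ) • c ∈ algebraicClasses A.X p := by
    rw [← hgc]
    exact map_mem_algebraicClasses_of_abelianVariety hA A₁ g.hom.hom.hom h₂
  exact (Submodule.smul_mem_iff _ (Rat.cast_ne_zero.2 hq)).1 h₃

/-- The same with `B_min` := (3). [cite: Andre1996Motifs, §6.3 a) (p. 33)] -/
theorem HC_AV_of_HC_CM_and_cmPointedPencilVHC (h₂₁ : andre1996_cmAnchoredPencil)
    (hCM : RankFourFaces.CMAbelianHodge) (hV : CMPointedPencilVHC) : PadicSemiregularLift.HodgeAbelianVarieties :=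
  HC_AV_of_HC_CM_and_Bmin h₂₁ hCM (cmAnchoredTransport_of_cmPointedPencilVHC hV)

/-- The same with `B_min` := (L) (the cycle-theoretic lift at CM fibres). [cite: Andre1996Motifs, §5.1 and §6.3 a)] -/
theorem HC_AV_of_HC_CM_and_cmFibreAlgebraicLift (h₂₁ : andre1996_cmAnchoredPencil)
    (hCM : RankFourFaces.CMAbelianHodge) (hL : CMFibreAlgebraicLift) : PadicSemiregularLift.HodgeAbelianVarieties :=
  HC_AV_of_HC_CM_and_Bmin h₂₁ hCM (cmAnchoredTransport_of_cmFibreAlgebraicLift hL)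

/-- **EXACTNESS of (4)**: granted Lemme 6.3.1, `HC_AV ↔ HC_CM ∧ CMAnchoredTransport` — (4) is necessary
(`cmAnchoredTransport_of_HC_AV`) and, with `HC_CM`, sufficient. The sharpening of deform's
`HC_AV_iff_HC_CM_and_compactAbelianPencilVHC_of_andre1996` ((2) replaced by the weaker-or-equal (4)).
[cite: Andre1996Motifs, Lemme 6.3.1 and Remarque 2 (pp. 31–33)] [cite: CharlesSchnell2014Notes, Cor. 11.3.6] -/
theorem HC_AV_iff_HC_CM_and_cmAnchoredTransport (h₂₁ : andre1996_cmAnchoredPencil) :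
    PadicSemiregularLift.HodgeAbelianVarieties ↔ (RankFourFaces.CMAbelianHodge ∧ CMAnchoredTransport) :=
  ⟨fun h ↦ ⟨HC_CM_of_HC_AV h, cmAnchoredTransport_of_HC_AV h⟩, fun h ↦ HC_AV_of_HC_CM_and_Bmin h₂₁ h.1 h.2⟩

/-- EXACTNESS of (3): granted Lemme 6.3.1, `HC_AV ↔ HC_CM ∧ CMPointedPencilVHC`.
[cite: Andre1996Motifs, Lemme 6.3.1 and Remarque 2 (pp. 31–33)] -/
theorem HC_AV_iff_HC_CM_and_cmPointedPencilVHC (h₂₁ : andre1996_cmAnchoredPencil) :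
    PadicSemiregularLift.HodgeAbelianVarieties ↔ (RankFourFaces.CMAbelianHodge ∧ CMPointedPencilVHC) :=
  ⟨fun h ↦ ⟨HC_CM_of_HC_AV h, cmPointedPencilVHC_of_HC_AV h⟩,
    fun h ↦ HC_AV_of_HC_CM_and_cmPointedPencilVHC h₂₁ h.1 h.2⟩

/-- **Under `HC_CM` (and Lemme 6.3.1) the candidates (2), (3), (4) COINCIDE** — all three are then equivalent
to `HC_AV`; the open converses (4) ⟹ (3) ⟹ (2) are open only in the absence of `HC_CM`.
[cite: Andre1996Motifs, Remarque 2 (p. 33)] -/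
theorem candidates_iff_of_HC_CM (h₂₁ : andre1996_cmAnchoredPencil) (hCM : RankFourFaces.CMAbelianHodge) :
    (CompactAbelianPencilVHC ↔ CMAnchoredTransport) ∧ (CMPointedPencilVHC ↔ CMAnchoredTransport) :=
  ⟨⟨fun h ↦ cmAnchoredTransport_of_cmPointedPencilVHC (cmPointedPencilVHC_of_compactAbelianPencilVHC h),
      fun h ↦ compactAbelianPencilVHC_of_HC_AV (HC_AV_of_HC_CM_and_Bmin h₂₁ hCM h)⟩,
    ⟨cmAnchoredTransport_of_cmPointedPencilVHC,
      fun h ↦ cmPointedPencilVHC_of_HC_AV (HC_AV_of_HC_CM_and_Bmin h₂₁ hCM h)⟩⟩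

/-- **The reduction item in AbelianAll form**: granted Lemme 6.3.1, `CMToAbelian ↔ (HC_CM → CMAnchoredTransport)`
— item stmt-16267 is "under `HC_CM`, algebraicity spreads out of CM fibres on compact pencils of abelian
varieties". Nothing here closes the item. [cite: Andre1996Motifs, Lemme 6.3.1 (p. 31)] -/
theorem cmToAbelian_iff_HC_CM_imp_cmAnchoredTransport (h₂₁ : andre1996_cmAnchoredPencil) :
    RankFourFaces.CMToAbelian ↔ (RankFourFaces.CMAbelianHodge → CMAnchoredTransport) := by
  constructor
  · intro h hCM
    exact cmAnchoredTransport_of_HC_AV (Hypotheses.hc_av_iff_hc_cm_and_cmToAbelian.2 ⟨hCM, h⟩)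
  · intro h hCM A _
    exact HC_AV_of_HC_CM_and_Bmin h₂₁ hCM (h hCM) A


end Summit.HodgeConjecture.HodgeConjecture.Ring2.AbelianAll

end
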